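import Mathlib
import Summits.Ventures.PercRepro2.Defs
import Summits.Ventures.PercRepro2.Independence
import Summits.Ventures.PercRepro2.Harris
import Summits.Ventures.PercRepro2.Graph
import Summits.Ventures.PercRepro2.Exploration
import Summits.Ventures.PercRepro2.Events
import Summits.Ventures.PercRepro2.Induced
import Summits.Ventures.PercRepro2.BHK
import Summits.Ventures.PercRepro2.BHKEvents
import Summits.Ventures.PercRepro2.OneEdge
import Summits.Ventures.PercRepro2.RBRoot
import Summits.Ventures.PercRepro2.RBRootEdge

/-!
# Parallel edges merge exactly (mine-a g5; MINE-A.md §25, the parallel-edge reduction)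

Two parallel edges `e ≠ e'` (`ends e = ends e'`) of weights `p e`, `p e'` are, for every event that
depends on the configuration only through the open graph, the same as one edge `e` of weight
`q = 1 − (1 − p e)(1 − p e')` and `e'` of weight `0`: `prob_merge_parallel`. The open graph of
`ω[e ↦ ω e ∨ ω e'][e' ↦ false]` is the open graph of `ω` (`openGraph_merge`), so connection
events, cluster events and the Rao–Blackwell sum are unchanged (`rbSum_merge_parallel`). This
removes the multiplicity condition on the marker edges from the kernel theorem (`RBKernelDefs`).
-/

namespace Summit.Ventures.PercRepro2

namespace RBParallel

open scoped Classical

section Merge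

variable {V : Type*} {E : Type*} [Fintype E] [DecidableEq E] {R : Type*} [Field R]
  (ends : E → Sym2 V)

omit [Fintype E] [Field R] in
/-- The open graph does not see which of two parallel edges is open. -/
lemma openGraph_merge {e e' : E} (hne : e ≠ e') (hpar : ends e = ends e') (ω : Config E) :
    openGraph ends (Function.update (Function.update ω e (ω e || ω e')) e' false) = openGraph ends ω := by
  ext u v
  rw [openGraph_adj, openGraph_adj]
  refine and_congr_right fun _ => ?_
  constructor
  · rintro ⟨f, hf, hends⟩
    by_cases hf' : f = e'
    · subst hf'; simp at hf
    · rw [Function.update_of_ne hf'] at hf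
      by_cases hfe : f = e
      · subst hfe
        rw [Function.update_self] at hf
        rcases Bool.or_eq_true_iff.1 hf with h | h
        · exact ⟨f, h, hends⟩
        · exact ⟨e', h, hpar ▸ hends⟩
      · rw [Function.update_of_ne hfe] at hf
        exact ⟨f, hf, hends⟩
  · rintro ⟨f, hf, hends⟩
    by_cases hfe : f = e
    · subst hfe
      exact ⟨f, by rw [Function.update_of_ne hne, Function.update_self, hf, Bool.true_or], hends⟩
    · by_cases hf' : f = e'
      · subst hf'
        exact ⟨e, by rw [Function.update_of_ne hne, Function.update_self, hf, Bool.or_true], hpar.trans hends⟩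
      · exact ⟨f, by rw [Function.update_of_ne hf', Function.update_of_ne hfe]; exact hf, hends⟩

omit [Fintype E] [Field R] in
/-- Connections do not see which of two parallel edges is open. -/
lemma conn_merge {e e' : E} (hne : e ≠ e') (hpar : ends e = ends e') (ω : Config E) (x y : V) :
    Conn ends (Function.update (Function.update ω e (ω e || ω e')) e' false) x y ↔ Conn ends ω x y := by
  unfold Conn
  rw [openGraph_merge ends hne hpar ω]

omit [Fintype E] [Field R] in
/-- Clusters do not see which of two parallel edges is open. -/
lemma cluster_merge {e e' : E} (hne : e ≠ e') (hpar : ends e = ends e') (ω : Config E) (v : V) :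
    cluster ends (Function.update (Function.update ω e (ω e || ω e')) e' false) v = cluster ends ω v := by
  ext u
  simp only [mem_cluster]
  exact conn_merge ends hne hpar ω v u

omit [Fintype E] in
/-- The merged weight vector is a probability vector. -/
lemma isProbVec_merge [LinearOrder R] [IsStrictOrderedRing R] {p : E → R} (hp : IsProbVec p)
    (e e' : E) : IsProbVec (Function.update (Function.update p e (p e + p e' - p e * p e')) e' 0) := by
  refine (hp.update e ?_ ?_).update e' le_rfl zero_le_one
  · nlinarith [hp.nonneg e, hp.nonneg e', hp.le_one e, hp.le_one e']
  · nlinarith [hp.nonneg e, hp.nonneg e', hp.le_one e, hp.le_one e',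
      mul_nonneg (sub_nonneg.2 (hp.le_one e)) (sub_nonneg.2 (hp.le_one e'))]

/-- **Parallel edges merge**: for an event `S` that depends on `e, e'` only through «at least one
of them is open», `P_p(S) = P_{p'}(S)` with `p' = p[e ↦ 1 − (1 − p e)(1 − p e')][e' ↦ 0]`. -/
theorem prob_merge_parallel (p : E → R) {e e' : E} (hne : e ≠ e') (S : Set (Config E))
    (hS : ∀ ω : Config E, ω ∈ S ↔ Function.update (Function.update ω e (ω e || ω e')) e' false ∈ S) :
    prob p S = prob (Function.update (Function.update p e (p e + p e' - p e * p e')) e' 0) S := by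
  -- the four pinned laws, expressed under `p` through the forcing identities
  set T : Set (Config E) := {ω | Function.update (Function.update ω e true) e' false ∈ S} with hT
  set T₀ : Set (Config E) := {ω | Function.update (Function.update ω e false) e' false ∈ S} with hT₀
  have c11 : ∀ ω : Config E, Function.update (Function.update (Function.update (Function.update ω e true)
      e' true) e ((Function.update (Function.update ω e true) e' true) e ||
        (Function.update (Function.update ω e true) e' true) e')) e' false =
      Function.update (Function.update ω e true) e' false := by
    intro ω
    funext x
    by_cases hx : x = e'
    · subst hx; simp
    · by_cases hx' : x = e
      · subst hx'; simp [hne]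
      · simp [hx, hx']
  have c01 : ∀ ω : Config E, Function.update (Function.update (Function.update (Function.update ω e false)
      e' true) e ((Function.update (Function.update ω e false) e' true) e ||
        (Function.update (Function.update ω e false) e' true) e')) e' false =
      Function.update (Function.update ω e true) e' false := by
    intro ω
    funext x
    by_cases hx : x = e'
    · subst hx; simp
    · by_cases hx' : x = e
      · subst hx'; simp [hne]
      · simp [hx, hx']
  have h11 : prob (Function.update (Function.update p e 1) e' 1) S = prob p T := by
    rw [RBRootEdge.prob_update_one_eq, RBRootEdge.prob_update_one_eq]
    congr 1
    ext ω
    simp only [Set.mem_setOf_eq, hT]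
    rw [hS (Function.update (Function.update ω e true) e' true), c11 ω]
  have h10 : prob (Function.update (Function.update p e 1) e' 0) S = prob p T := by
    rw [RBRootEdge.prob_update_zero_eq, RBRootEdge.prob_update_one_eq]
    rfl
  have h01 : prob (Function.update (Function.update p e 0) e' 1) S = prob p T := by
    rw [RBRootEdge.prob_update_one_eq, RBRootEdge.prob_update_zero_eq]
    congr 1
    ext ω
    simp only [Set.mem_setOf_eq, hT]
    rw [hS (Function.update (Function.update ω e false) e' true), c01 ω]
  have h00 : prob (Function.update (Function.update p e 0) e' 0) S = prob p T₀ := by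
    rw [RBRootEdge.prob_update_zero_eq, RBRootEdge.prob_update_zero_eq]
    rfl
  have hq1 : Function.update (Function.update (Function.update p e (p e + p e' - p e * p e')) e' 0) e 1 =
      Function.update (Function.update p e 1) e' 0 := by
    rw [Function.update_comm hne.symm, Function.update_idem]
  have hq0 : Function.update (Function.update (Function.update p e (p e + p e' - p e * p e')) e' 0) e 0 =
      Function.update (Function.update p e 0) e' 0 := by
    rw [Function.update_comm hne.symm, Function.update_idem]
  rw [prob_eq_pin p S e, prob_eq_pin (Function.update p e 1) S e', prob_eq_pin (Function.update p e 0) S e',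
    Function.update_of_ne hne.symm, Function.update_of_ne hne.symm, h11, h10, h01, h00,
    prob_eq_pin (Function.update (Function.update p e (p e + p e' - p e * p e')) e' 0) S e,
    Function.update_of_ne hne, Function.update_self, hq1, hq0, h10, h00]
  ring

end Merge

section RBSum

variable {V : Type*} {E : Type*} [Fintype E] [DecidableEq E] [Fintype V] {R : Type*} [Field R]
  (ends : E → Sym2 V) (s t w : V)

omit [Fintype E] [Fintype V] in
/-- The row's events (`Q`, connection events, cluster atoms and their intersections) depend on
parallel edges only through «at least one open». -/
lemma mem_merge_iff {e e' : E} (hne : e ≠ e') (hpar : ends e = ends e') (ω : Config E) (x y : V)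
    (A : Set V) :
    (ω ∈ connEvent ends x y ↔
        Function.update (Function.update ω e (ω e || ω e')) e' false ∈ connEvent ends x y) ∧
      (ω ∈ clusterEvent ends w A ↔
        Function.update (Function.update ω e (ω e || ω e')) e' false ∈ clusterEvent ends w A) := by
  simp only [mem_connEvent, mem_clusterEvent]
  exact ⟨(conn_merge ends hne hpar ω x y).symm, by rw [cluster_merge ends hne hpar ω w]⟩

/-- **The Rao–Blackwell sum and the three masses of the row do not see the multiplicity of a
parallel pair**: merging `e, e'` into `e` of weight `1 − (1 − p e)(1 − p e')` changes nothing. -/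
theorem rbSum_merge_parallel (p : E → R) {e e' : E} (hne : e ≠ e') (hpar : ends e = ends e')
    (x₁ y₁ x₂ y₂ : V) :
    RBRoot.rbSum p ends s t w (connEvent ends x₁ y₁) (connEvent ends x₂ y₂) =
      RBRoot.rbSum (Function.update (Function.update p e (p e + p e' - p e * p e')) e' 0) ends s t w
        (connEvent ends x₁ y₁) (connEvent ends x₂ y₂) := by
  unfold RBRoot.rbSum
  refine Finset.sum_congr rfl fun A _ => ?_
  have hQC : ∀ ω : Config E, ω ∈ (connEvent ends s t)ᶜ ∩ clusterEvent ends w A ↔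
      Function.update (Function.update ω e (ω e || ω e')) e' false ∈
        (connEvent ends s t)ᶜ ∩ clusterEvent ends w A := by
    intro ω
    simp only [Set.mem_inter_iff, Set.mem_compl_iff]
    exact and_congr (not_congr (mem_merge_iff ends w hne hpar ω s t A).1)
      (mem_merge_iff ends w hne hpar ω s t A).2
  have hX : ∀ (x y : V) (ω : Config E),
      ω ∈ (connEvent ends s t)ᶜ ∩ clusterEvent ends w A ∩ connEvent ends x y ↔
      Function.update (Function.update ω e (ω e || ω e')) e' false ∈
        (connEvent ends s t)ᶜ ∩ clusterEvent ends w A ∩ connEvent ends x y := by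
    intro x y ω
    simp only [Set.mem_inter_iff, Set.mem_compl_iff]
    exact and_congr (and_congr (not_congr (mem_merge_iff ends w hne hpar ω s t A).1)
      (mem_merge_iff ends w hne hpar ω s t A).2) (mem_merge_iff ends w hne hpar ω x y A).1
  rw [prob_merge_parallel p hne _ (hX x₁ y₁), prob_merge_parallel p hne _ (hX x₂ y₂),
    prob_merge_parallel p hne _ hQC]

omit [Fintype V] in
/-- The masses `P(Q ∩ {x ↔ y})`, `P(Q)` do not see the multiplicity of a parallel pair. -/
theorem prob_merge_parallel_conn (p : E → R) {e e' : E} (hne : e ≠ e') (hpar : ends e = ends e')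
    (x y : V) :
    prob p ((connEvent ends s t)ᶜ ∩ connEvent ends x y) =
        prob (Function.update (Function.update p e (p e + p e' - p e * p e')) e' 0)
          ((connEvent ends s t)ᶜ ∩ connEvent ends x y) ∧
      prob p (connEvent ends s t)ᶜ =
        prob (Function.update (Function.update p e (p e + p e' - p e * p e')) e' 0)
          (connEvent ends s t)ᶜ := by
  constructor
  · refine prob_merge_parallel p hne _ fun ω => ?_
    simp only [Set.mem_inter_iff, Set.mem_compl_iff, mem_connEvent]
    exact and_congr (not_congr (conn_merge ends hne hpar ω s t).symm) (conn_merge ends hne hpar ω x y).symm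
  · refine prob_merge_parallel p hne _ fun ω => ?_
    simp only [Set.mem_compl_iff, mem_connEvent]
    exact not_congr (conn_merge ends hne hpar ω s t).symm

end RBSum

end RBParallel

end Summit.Ventures.PercRepro2
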